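/-
Copyright (c) 2026 the pub-hodgecm-mathlib formalisation cell (harness21).  Prover seat hodgecm-mathlib-K2E3-p03 (g4), Track B «K2-LIT» ∕ h413
(`stmt-HodgeConjecture-24833`), line `K2_E3_EllipticInputs`, unit U12, road «GL-[M6]-sc» (line lead K2E3-p23 (g5), deal (M11-2) ∕ RULINGS #12 dedup),
brick B4-1m, FILE 3 OF 3: HAAR-A.E. `x ∈ G' = GL₃(F) ⧸ ϖ^ℤ·1` HAS A REGULAR SEMISIMPLE LIFT — `disc χ ≠ 0`, SEPARABLE, IN SPLIT ∕ MIXED ∕ ELLIPTIC NORMAL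
FORM; EQUIVALENTLY: A.E. `x` HAS COMPACT CENTRALISER OR A SPLIT ∕ MIXED NORMAL-FORM LIFT.  2026-09-04.
-/
import Summits.HodgeConjecture.HodgeConjecture.Theorems.K2E3GL3ModUniformizerHaarTransfer        -- ★ B4-1m file 2 (this seat): `ae_of_ae_comp_mk` (the a.e.-transfer `GL₃(F) → G'`)
import Summits.HodgeConjecture.HodgeConjecture.Theorems.K2E3GL3CharpolyDiscNullHaar             -- ★ (N0) p858121 (K2E3-p17 (g7)): `ae_discr_charpoly_ne_zero`, `normalForm_of_discr_ne_zero`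
import Summits.HodgeConjecture.HodgeConjecture.Theorems.K2E3GL3ModUniformizerCentralizerCompact  -- ★ B4-1d file 2 (this seat): `isCompact_centralizer_mk_of_irreducible`
import HarnessLib

/-!
# K2_E3 road (h413), road «GL-[M6]-sc», brick B4-1m (file 3 of 3) — Haar-a.e. `x ∈ G'` has a regular semisimple lift (separable, in normal form)

Cell `pub/hodgecm-mathlib` (D-0151), Track B (21-frontier RULING «PUSH BOTH» 2026-09-03, director req624), seat K2E3-p03 (g4); by-name deal (M11-2) of the
line lead K2E3-p23 (g5) (squad bus 2026-09-04T06:52:23Z) with the RULINGS #12 dedup «consume K2E3-p17 (g7)'s (N0) upstairs and only push it through F2».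
`--supports stmt-HodgeConjecture-24833 --as helper`; THEOREMS ONLY (no definition ∕ instance ∕ notation ∕ named fact ∕ `sorry`); never imports `Cruxes/…/Lines`.
COUNT-NEUTRAL: this is the a.e. case split from which the assembly (ASM) of the leaf (11-3-split-sc-NE) starts; it closes no socket by itself.

`G' := GL (Fin 3) F ⧸ N'`, `N' := (Subgroup.zpowers (Units.mk0 ϖ hϖ0)).map (Matrix.GeneralLinearGroup.scalar (Fin 3))` (spelled out; binder-style
`[MeasurableSpace G'] [BorelSpace G']`; NO measurable structure on `GL₃(F)` in the statements — the Borel one and Mathlib's `Measure.haar` are chosen inside).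

THE RESULTS (`μ'` ANY Haar measure of `G'`):
* `isOpen_setOf_discr_charpoly_ne_zero` — `{g ∈ GL₃(F) | disc χ_g ≠ 0}` is open (★ `continuous_discr_charpoly`); `measurableSet_setOf_exists_mk_eq_discr_ne_zero` —
  its image `{x | ∃ g, mk g = x ∧ disc χ_g ≠ 0}` is open (`mk` is an open map), hence measurable;
* **`ae_exists_mk_eq_discr_ne_zero`** — `∀ᵐ x ∂μ', ∃ g, mk g = x ∧ disc χ_g ≠ 0` (★ (N0) `ae_discr_charpoly_ne_zero` for `Measure.haar` on `GL₃(F)`, pushed through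
  ★ F2 `ae_of_ae_comp_mk`);
* **`ae_exists_mk_eq_separable`** — `∀ᵐ x ∂μ', ∃ g, mk g = x ∧ χ_g separable` (★ R′ `separable_of_discr_ne_zero`);
* **`ae_exists_mk_eq_normalForm`** — `∀ᵐ x ∂μ', ∃ g, mk g = x ∧ disc χ_g ≠ 0 ∧ (split ∨ mixed ∨ elliptic)` (★ (N0) `normalForm_of_discr_ne_zero`);
* **`ae_isCompact_centralizer_or_normalForm`** (THE ASM FORM) — for a.e. `x ∈ G'`: EITHER `Z_{G'}(x)` is compact (elliptic, ★ B4-1d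
  `isCompact_centralizer_mk_of_irreducible`) OR `x = mk g` with `χ_g` separable and `g = y·diag d·y⁻¹` (`d` injective) or `g = y·M(m)·y⁻¹` (irreducible `2 × 2` block).
[HarishChandra1970, Part VII §3 pp. 70–73; HarishChandra1999AdmissibleDistributions, §7; Cartier1979, §I.3–I.4]
HONEST LABEL: HC_CM is proved only modulo the 7 printed citations (2 remaining named inputs: hLiu418 = stmt-HodgeConjecture-24832, h413 =
stmt-HodgeConjecture-24833) until rung 0 closes; count-neutral helper.

## References
* [HarishChandra1970] Harish-Chandra (notes by G. van Dijk), *Harmonic Analysis on Reductive p-adic Groups*, LNM 162 (1970), Part VII §3.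
* [HarishChandra1999AdmissibleDistributions] Harish-Chandra (notes by S. DeBacker, P. J. Sally), *Admissible Invariant Distributions on Reductive p-adic Groups*,
  AMS ULS 16 (1999), §7.
* [Cartier1979] P. Cartier, *Representations of p-adic groups: a survey*, Corvallis (1979), §I.3–I.4.
-/

set_option autoImplicit false
set_option linter.dupNamespace false   -- `Summit.HodgeConjecture.HodgeConjecture.…` (D-0017 nested layout; lakefile exemption for Summits)

noncomputable section

open MeasureTheory Measure Topology
open scoped Matrix MatrixGroups WithZero
open Summit.HodgeConjecture.HodgeConjecture.Cruxes.H413.K2E3CharpolyRootsPerturbation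
open Summit.HodgeConjecture.HodgeConjecture.Cruxes.H413.K2E3GL3ModCentre
open Summit.HodgeConjecture.HodgeConjecture.Cruxes.H413.K2E3GL3ModUniformizerCentralizerCompact
open Summit.HodgeConjecture.HodgeConjecture.Cruxes.H413.K2E3GL3ModUniformizerHaarTransfer
open Summit.HodgeConjecture.HodgeConjecture.Cruxes.H413.K2E3GL3CharpolyDiscNullHaar

namespace Summit.HodgeConjecture.HodgeConjecture.Cruxes.H413.K2E3GL3ModUniformizerSeparableAE

variable {F : Type*} [Field F] [Valued F ℤᵐ⁰] [ValuativeRel F] [(Valued.v : Valuation F ℤᵐ⁰).Compatible] [IsNonarchimedeanLocalField F]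

omit [(Valued.v : Valuation F ℤᵐ⁰).Compatible] in
/-- The regular semisimple set `{g ∈ GL₃(F) | disc χ_g ≠ 0}` is open (★ `continuous_discr_charpoly`). [cite: HarishChandra1999AdmissibleDistributions, §7] -/
theorem isOpen_setOf_discr_charpoly_ne_zero : IsOpen {g : GL (Fin 3) F | (g : Matrix (Fin 3) (Fin 3) F).charpoly.discr ≠ 0} :=
  isOpen_ne_fun ((F0P3cStCharTSHCDGroupToLie.continuous_discr_charpoly (K := F)).comp Units.continuous_val) continuous_const

variable {ϖ : F} (hϖ : Valued.v ϖ = WithZero.exp (-1 : ℤ)) (hϖ0 : ϖ ≠ 0)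
  [((Subgroup.zpowers (Units.mk0 ϖ hϖ0)).map (Matrix.GeneralLinearGroup.scalar (Fin 3))).Normal]
  [MeasurableSpace (GL (Fin 3) F ⧸ (Subgroup.zpowers (Units.mk0 ϖ hϖ0)).map (Matrix.GeneralLinearGroup.scalar (Fin 3)))]
  [BorelSpace (GL (Fin 3) F ⧸ (Subgroup.zpowers (Units.mk0 ϖ hϖ0)).map (Matrix.GeneralLinearGroup.scalar (Fin 3)))]

omit [(Valued.v : Valuation F ℤᵐ⁰).Compatible] [((Subgroup.zpowers (Units.mk0 ϖ hϖ0)).map (Matrix.GeneralLinearGroup.scalar (Fin 3))).Normal] in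
/-- `{x ∈ G' | ∃ g, mk g = x ∧ disc χ_g ≠ 0} = mk({disc ≠ 0})` is open (`mk` is an open map), hence measurable. [cite: Cartier1979, §I.3] -/
theorem measurableSet_setOf_exists_mk_eq_discr_ne_zero :
    MeasurableSet {x : GL (Fin 3) F ⧸ (Subgroup.zpowers (Units.mk0 ϖ hϖ0)).map (Matrix.GeneralLinearGroup.scalar (Fin 3)) |
      ∃ g : GL (Fin 3) F, (QuotientGroup.mk g : GL (Fin 3) F ⧸ (Subgroup.zpowers (Units.mk0 ϖ hϖ0)).map (Matrix.GeneralLinearGroup.scalar (Fin 3))) = x ∧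
        (g : Matrix (Fin 3) (Fin 3) F).charpoly.discr ≠ 0} := by
  have h : {x : GL (Fin 3) F ⧸ (Subgroup.zpowers (Units.mk0 ϖ hϖ0)).map (Matrix.GeneralLinearGroup.scalar (Fin 3)) |
      ∃ g : GL (Fin 3) F, (QuotientGroup.mk g : GL (Fin 3) F ⧸ (Subgroup.zpowers (Units.mk0 ϖ hϖ0)).map (Matrix.GeneralLinearGroup.scalar (Fin 3))) = x ∧
        (g : Matrix (Fin 3) (Fin 3) F).charpoly.discr ≠ 0} =
      (QuotientGroup.mk : GL (Fin 3) F → GL (Fin 3) F ⧸ (Subgroup.zpowers (Units.mk0 ϖ hϖ0)).map (Matrix.GeneralLinearGroup.scalar (Fin 3))) ''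
        {g : GL (Fin 3) F | (g : Matrix (Fin 3) (Fin 3) F).charpoly.discr ≠ 0} := by
    ext x
    simp only [Set.mem_setOf_eq, Set.mem_image]
    constructor
    · rintro ⟨g, hg, hd⟩
      exact ⟨g, hd, hg⟩
    · rintro ⟨g, hd, hg⟩
      exact ⟨g, hg, hd⟩
  have ho : IsOpen ((QuotientGroup.mk : GL (Fin 3) F → GL (Fin 3) F ⧸ (Subgroup.zpowers (Units.mk0 ϖ hϖ0)).map (Matrix.GeneralLinearGroup.scalar (Fin 3))) ''
      {g : GL (Fin 3) F | (g : Matrix (Fin 3) (Fin 3) F).charpoly.discr ≠ 0}) :=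
    QuotientGroup.isOpenMap_coe _ isOpen_setOf_discr_charpoly_ne_zero
  rw [h]
  exact ho.measurableSet

include hϖ in
/-- **Haar-a.e. `x ∈ G'` has a regular semisimple lift**: `∀ᵐ x ∂μ', ∃ g, mk g = x ∧ disc χ_g ≠ 0` (★ (N0) upstairs for Mathlib's `Measure.haar` on `GL₃(F)`,
★ B4-1m F2 `ae_of_ae_comp_mk`). [cite: HarishChandra1970, Part VII §3; cite: HarishChandra1999AdmissibleDistributions, §7] -/
theorem ae_exists_mk_eq_discr_ne_zero
    (μ' : Measure (GL (Fin 3) F ⧸ (Subgroup.zpowers (Units.mk0 ϖ hϖ0)).map (Matrix.GeneralLinearGroup.scalar (Fin 3)))) [μ'.IsHaarMeasure] :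
    ∀ᵐ x ∂μ', ∃ g : GL (Fin 3) F, (QuotientGroup.mk g : GL (Fin 3) F ⧸ (Subgroup.zpowers (Units.mk0 ϖ hϖ0)).map (Matrix.GeneralLinearGroup.scalar (Fin 3))) = x ∧
      (g : Matrix (Fin 3) (Fin 3) F).charpoly.discr ≠ 0 := by
  letI : MeasurableSpace (GL (Fin 3) F) := borel _
  haveI : BorelSpace (GL (Fin 3) F) := ⟨rfl⟩
  letI : MeasurableSpace (Matrix (Fin 3) (Fin 3) F) := borel _
  haveI : BorelSpace (Matrix (Fin 3) (Fin 3) F) := ⟨rfl⟩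
  haveI : LocallyCompactSpace (GL (Fin 3) F) := locallyCompactSpace_gl3 F
  exact ae_of_ae_comp_mk hϖ hϖ0 (Measure.haar : Measure (GL (Fin 3) F)) μ' (measurableSet_setOf_exists_mk_eq_discr_ne_zero hϖ0)
    ((ae_discr_charpoly_ne_zero (Measure.haar : Measure (GL (Fin 3) F))).mono fun g hg => ⟨g, rfl, hg⟩)

include hϖ in
/-- **Haar-a.e. `x ∈ G'` has a lift with SEPARABLE characteristic polynomial** (★ R′ `separable_of_discr_ne_zero`). [cite: HarishChandra1970, Part VII §3] -/
theorem ae_exists_mk_eq_separable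
    (μ' : Measure (GL (Fin 3) F ⧸ (Subgroup.zpowers (Units.mk0 ϖ hϖ0)).map (Matrix.GeneralLinearGroup.scalar (Fin 3)))) [μ'.IsHaarMeasure] :
    ∀ᵐ x ∂μ', ∃ g : GL (Fin 3) F, (QuotientGroup.mk g : GL (Fin 3) F ⧸ (Subgroup.zpowers (Units.mk0 ϖ hϖ0)).map (Matrix.GeneralLinearGroup.scalar (Fin 3))) = x ∧
      (g : Matrix (Fin 3) (Fin 3) F).charpoly.Separable := by
  filter_upwards [ae_exists_mk_eq_discr_ne_zero hϖ hϖ0 μ'] with x hx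
  obtain ⟨g, hgx, hD⟩ := hx
  exact ⟨g, hgx, separable_of_discr_ne_zero (Matrix.charpoly_monic _) (by rw [Matrix.charpoly_natDegree_eq_dim, Fintype.card_fin]; norm_num) hD⟩

include hϖ in
/-- **Haar-a.e. `x ∈ G'` has a regular semisimple lift in NORMAL FORM**: split (`y·diag d·y⁻¹`, `d` injective) ∨ mixed (`y·M(m)·y⁻¹`, irreducible `2 × 2` block)
∨ elliptic (`χ` irreducible) (★ (N0) `normalForm_of_discr_ne_zero`). [cite: HarishChandra1970, Part VII §3; cite: HarishChandra1999AdmissibleDistributions, §7] -/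
theorem ae_exists_mk_eq_normalForm
    (μ' : Measure (GL (Fin 3) F ⧸ (Subgroup.zpowers (Units.mk0 ϖ hϖ0)).map (Matrix.GeneralLinearGroup.scalar (Fin 3)))) [μ'.IsHaarMeasure] :
    ∀ᵐ x ∂μ', ∃ g : GL (Fin 3) F, (QuotientGroup.mk g : GL (Fin 3) F ⧸ (Subgroup.zpowers (Units.mk0 ϖ hϖ0)).map (Matrix.GeneralLinearGroup.scalar (Fin 3))) = x ∧
      (g : Matrix (Fin 3) (Fin 3) F).charpoly.discr ≠ 0 ∧
      ((∃ (y : GL (Fin 3) F) (d : Fin 3 → F), Function.Injective d ∧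
          (g : Matrix (Fin 3) (Fin 3) F) = (y : Matrix (Fin 3) (Fin 3) F) * Matrix.diagonal d * ((y⁻¹ : GL (Fin 3) F) : Matrix (Fin 3) (Fin 3) F)) ∨
        (∃ (y : GL (Fin 3) F) (m : Fin 5 → F), Irreducible (!![m 0, m 1; m 2, m 3] : Matrix (Fin 2) (Fin 2) F).charpoly ∧
          (g : Matrix (Fin 3) (Fin 3) F) = (y : Matrix (Fin 3) (Fin 3) F) * !![m 0, m 1, 0; m 2, m 3, 0; 0, 0, m 4] * ((y⁻¹ : GL (Fin 3) F) : Matrix (Fin 3) (Fin 3) F)) ∨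
        Irreducible (g : Matrix (Fin 3) (Fin 3) F).charpoly) := by
  filter_upwards [ae_exists_mk_eq_discr_ne_zero hϖ hϖ0 μ'] with x hx
  obtain ⟨g, hgx, hD⟩ := hx
  exact ⟨g, hgx, hD, normalForm_of_discr_ne_zero _ hD⟩

include hϖ in
/-- **THE ASM FORM of the a.e. case split**: for Haar-a.e. `x ∈ G'`, EITHER the centraliser `Z_{G'}(x)` is COMPACT (elliptic, ★ B4-1d), OR `x = mk g` with `χ_g`
separable and `g = y·diag d·y⁻¹` (`d` injective: split) or `g = y·M(m)·y⁻¹` (irreducible `2 × 2` block: mixed).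
[cite: HarishChandra1970, Part VII §3 pp. 70–73; cite: Cartier1979, §I.3–I.4] -/
theorem ae_isCompact_centralizer_or_normalForm
    (μ' : Measure (GL (Fin 3) F ⧸ (Subgroup.zpowers (Units.mk0 ϖ hϖ0)).map (Matrix.GeneralLinearGroup.scalar (Fin 3)))) [μ'.IsHaarMeasure] :
    ∀ᵐ x ∂μ', IsCompact ((Subgroup.centralizer {x} : Subgroup (GL (Fin 3) F ⧸ (Subgroup.zpowers (Units.mk0 ϖ hϖ0)).map (Matrix.GeneralLinearGroup.scalar (Fin 3)))) :
        Set (GL (Fin 3) F ⧸ (Subgroup.zpowers (Units.mk0 ϖ hϖ0)).map (Matrix.GeneralLinearGroup.scalar (Fin 3)))) ∨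
      ∃ g : GL (Fin 3) F, (QuotientGroup.mk g : GL (Fin 3) F ⧸ (Subgroup.zpowers (Units.mk0 ϖ hϖ0)).map (Matrix.GeneralLinearGroup.scalar (Fin 3))) = x ∧
        (g : Matrix (Fin 3) (Fin 3) F).charpoly.Separable ∧
        ((∃ (y : GL (Fin 3) F) (d : Fin 3 → F), Function.Injective d ∧
            (g : Matrix (Fin 3) (Fin 3) F) = (y : Matrix (Fin 3) (Fin 3) F) * Matrix.diagonal d * ((y⁻¹ : GL (Fin 3) F) : Matrix (Fin 3) (Fin 3) F)) ∨
          ∃ (y : GL (Fin 3) F) (m : Fin 5 → F), Irreducible (!![m 0, m 1; m 2, m 3] : Matrix (Fin 2) (Fin 2) F).charpoly ∧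
            (g : Matrix (Fin 3) (Fin 3) F) = (y : Matrix (Fin 3) (Fin 3) F) * !![m 0, m 1, 0; m 2, m 3, 0; 0, 0, m 4] * ((y⁻¹ : GL (Fin 3) F) : Matrix (Fin 3) (Fin 3) F)) := by
  filter_upwards [ae_exists_mk_eq_discr_ne_zero hϖ hϖ0 μ'] with x hx
  obtain ⟨g, rfl, hD⟩ := hx
  have hsep : (g : Matrix (Fin 3) (Fin 3) F).charpoly.Separable :=
    separable_of_discr_ne_zero (Matrix.charpoly_monic _) (by rw [Matrix.charpoly_natDegree_eq_dim, Fintype.card_fin]; norm_num) hD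
  rcases normalForm_of_discr_ne_zero _ hD with h | h | h
  · exact Or.inr ⟨g, rfl, hsep, Or.inl h⟩
  · exact Or.inr ⟨g, rfl, hsep, Or.inr h⟩
  · exact Or.inl (isCompact_centralizer_mk_of_irreducible hϖ hϖ0 g h)

end Summit.HodgeConjecture.HodgeConjecture.Cruxes.H413.K2E3GL3ModUniformizerSeparableAE
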